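import Summits.QuantumAdvantage.QuantumAdvantage.Theses.SelmerBand

/-!
# Line `birth` — BC3 skeleton for the crux `BeyondConstant` (stmt-QuantumAdvantage-17068)

Route `SelmerBand` (route-QuantumAdvantage-SelmerBand; deciding theorem
`closes : PriorBand → SelmerMemBQP → BeyondConstant → QuantumAdvantage`), crux rank 4, HYPOTHESIS-TYPE
(conjecture-grade; refuters first):

  `BeyondConstant := ∀ PPT A, ∃ᶠ X, avg_{H(E_{A,B}) < X} Pr[A(enc(A,B)) = b(A,B)] ≤ max(π_X, 1 − π_X) + 1/20`,

`b(A,B) = [#Sel₂(E_{A,B}) ≤ 2]` the non-parity Selmer bit, `π_X` its proportion below height `X`.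

## The line: predictor calibration + law of total covariance along SELMER PARITY

Write `p(A,B) := Pr[A accepts enc(A,B)]`, `t_X := avg p` (acceptance rate), and let
`Cov_X(A) := avg(p·b) − π_X·t_X` be the empirical covariance of acceptance with the Selmer bit over the
curves of height `< X`.  Two TRUE finite-sum lemmas and two hardness stubs:

* `stub_successCalibration` (TRUE, size M): `avgSuccess ≤ max(π, 1−π) + 2·Cov` — in fact the identity
  `avgSuccess = 2·Cov + (1−π) + (2π−1)·t` (split the sum over `b = 1` / `b = 0`, `Pr[A = false] = 1 − p`
  because `RandAlg.pr` is the mass of a `PMF`, `enc` injective by `Computability.decode_encodeNat`, and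
  `enc(A,B) ∈ L ↔ b(A,B)` on the family), then `(1−π) + (2π−1)t ≤ max(π, 1−π)` for `t ∈ [0,1]`.  The factor 2
  is sharp (`π = 1/2`).
* `stub_parityDecomposition` (TRUE, size M): the law of total covariance for the binary class
  `q(A,B) := [#Sel₂(E_{A,B}) is a square]` (= `dim Sel₂` even; by 2-parity = root number `+1` off the
  density-zero locus `E(ℚ)[2] ≠ 0`): `Cov = WithinParityCov + ParityCov·(E[b | q] − E[b | ¬q])`, hence
  `Cov ≤ WithinParityCov + |ParityCov|` (junk conventions `x/0 = 0` included; checked on exact rationals,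
  `sanity_identities.py` in the registrar's folder).
* `stub_parityDark` (HARDNESS, the delicate channel, weakest `∃ᶠ` form): for every PPT `A`, infinitely often
  `|ParityCov_X(A)| ≤ 1/80` — no efficient statistic correlates with 2-Selmer PARITY.  This is where the
  route's recorded leak lives: `w(E_{A,B})` is polynomial-time GIVEN the factorisation of `4A³ + 27B²`
  (Rohrlich/Halberstadt), the factoring-free part of `w` is a Jacobi symbol and the residual sign is the
  Liouville-type parity of the unfactored cofactor (grounder/refuter notes on the item; Helfgott
  arXiv:math/0305435); a perfect `w`-oracle has `ParityCov = 1/4` under Poonen–Rains.  The stub asserts the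
  density of PPT-resolvable discriminants tends to `0` and no factoring-free route to `w` exists.
* `stub_residueDark` (HARDNESS, the Poonen–Rains residue, `∀ᶠ` form): for every PPT `A`, eventually
  `WithinParityCov_X(A) ≤ 1/80` — conditioned on Selmer parity, no efficient statistic correlates with
  `[#Sel₂ ≤ 2]` (the BKLPR/Poonen–Rains "random beyond parity" heuristic, arXiv:1009.0287 Conj. 1.1,
  believed at every scale, hence the eventual form).
* Composition (sorry-free): at an `X` given by `parityDark.and_eventually residueDark`,
  `avg ≤ max + 2(Within + |ParityCov|) ≤ max + 2(1/80 + 1/80) = max + 1/20`; `beyondConstant_of_stubs`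
  takes the four stub statements as hypotheses and concludes the unfolded crux, `beyondConstant_iff` is
  `Iff.rfl`, and `BeyondConstant_of : BeyondConstant` is the ONLY theorem whose head is the crux decl.

Why this cut: it types, for the first time, the informal parity/non-parity analysis of the route header
and of the grounder + refuter notes on the item (parity leak ≈ +0.081 under PR for a `w`-oracle; `q > 0.926`
root-number accuracy needed to break the margin) as two separately attackable hardness statements — a
refuter kills `stub_parityDark` with a root-number emulator and `stub_residueDark` with a conditional
statistic — while the two calibration stubs are theorems of finite sums provable now.

Disproof used: none exists for this crux (`ledger crux ls stmt-QuantumAdvantage-17068`: no workfiles — no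
`Disproof.lean`, no `Theorems/BeyondConstant/Negative/*`; `ledger negatives --problem QuantumAdvantage` has no
SelmerBand item).  `sorry` occurs ONLY in the four `stub_*` theorems.
-/

-- `Summit.<Summit>.<Problem>`: for the single-conjunct summit the duplicate `QuantumAdvantage.QuantumAdvantage` is mandated.
set_option linter.dupNamespace false
set_option linter.unusedVariables false

noncomputable section

namespace Summit.QuantumAdvantage.QuantumAdvantage.Cruxes.BeyondConstant.Birth

open scoped Classical
open Summit.QuantumAdvantage.QuantumAdvantage.Theses.SelmerBand
open Literature.Computability.Complexity Literature.NumberTheory.EllipticCurves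

/-! ## The objects of the crux, named (verbatim sub-terms of the route decl `BeyondConstant`) -/

/-- The non-parity Selmer bit as a set: `{(A,B) | #Sel₂(E_{A,B}/ℚ) ≤ 2}` (membership is, by `rfl`, the `P`
of the route decl). [folklore] -/
def selmerLowSet : Set (ℤ × ℤ) :=
  {AB | Nat.card ((shortWeierstrass AB).selmerGroup 2) ≤ 2}

/-- The Selmer PARITY class as a set: `{(A,B) | #Sel₂(E_{A,B}/ℚ) is a perfect square}`, i.e. `dim_𝔽₂ Sel₂` even
(`#Sel₂ = 2^s` on the family, `exists_natCard_selmerGroup_eq_pow`); by the 2-parity theorem this is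
`w(E_{A,B}) = +1` whenever `E(ℚ)[2] = 0`. [folklore] -/
def selmerEvenSet : Set (ℤ × ℤ) :=
  {AB | IsSquare (Nat.card ((shortWeierstrass AB).selmerGroup 2))}

/-- The input encoding `enc = encodeNat ∘ Encodable.encode` on `ℤ × ℤ` (the `enc` of the route decl). [folklore] -/
def enc (AB : ℤ × ℤ) : List Bool :=
  Computability.encodeNat (Encodable.encode AB)

/-- The witness language `L = enc '' {(A,B) ∈ height family | #Sel₂ ≤ 2}` (the `L` of the route decl). [folklore] -/
def selmerLang : Language Bool :=
  enc '' {AB | IsInHeightFamily AB ∧ AB ∈ selmerLowSet}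

/-- Acceptance probability `p(A,B) = Pr_r[A(enc(A,B); r) = true]`. [folklore] -/
def accept (A : RandAlg (List Bool) Bool) (AB : ℤ × ℤ) : ℝ :=
  A.pr id (enc AB) {true}

/-- Average success of `A` at predicting the Selmer bit over the curves of naive height `< X`
(verbatim the left-hand side of the crux; junk value `0` on an empty family). [folklore] -/
def avgSuccess (A : RandAlg (List Bool) Bool) (X : ℕ) : ℝ :=
  (∑ AB ∈ heightFamilyBelow X, A.pr id (enc AB) {Set.boolIndicator selmerLang (enc AB)}) /
    ((heightFamilyBelow X).card : ℝ)

/-- The prior `π_X`: proportion of curves of height `< X` with `#Sel₂ ≤ 2`. [folklore] -/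
def prior (X : ℕ) : ℝ :=
  heightProportion (fun AB => AB ∈ selmerLowSet) X

/-- Acceptance rate `t_X(A) = avg_{H < X} p`. [folklore] -/
def acceptRate (A : RandAlg (List Bool) Bool) (X : ℕ) : ℝ :=
  heightAverage (accept A) X

/-- `Cov_X(A) = avg(p·b) − π_X·t_X`: empirical covariance of acceptance with the Selmer bit. [folklore] -/
def selmerCov (A : RandAlg (List Bool) Bool) (X : ℕ) : ℝ :=
  heightAverage (fun AB => if AB ∈ selmerLowSet then accept A AB else 0) X - prior X * acceptRate A X

/-- `ParityCov_X(A) = avg(p·q) − (proportion of q)·t_X`: empirical covariance of acceptance with Selmer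
parity. [folklore] -/
def parityCov (A : RandAlg (List Bool) Bool) (X : ℕ) : ℝ :=
  heightAverage (fun AB => if AB ∈ selmerEvenSet then accept A AB else 0) X -
    heightProportion (fun AB => AB ∈ selmerEvenSet) X * acceptRate A X

/-- Class average: the average of `f` over the curves of height `< X` lying in the class `Q`
(junk value `0` when the class is empty). [folklore] -/
def classAverage (Q : ℤ × ℤ → Prop) (f : ℤ × ℤ → ℝ) (X : ℕ) : ℝ :=
  (∑ AB ∈ (heightFamilyBelow X).filter (fun AB => Q AB), f AB) /
    (((heightFamilyBelow X).filter (fun AB => Q AB)).card : ℝ)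

/-- Within-class covariance of acceptance with the Selmer bit, inside the class `Q`. [folklore] -/
def classCov (Q : ℤ × ℤ → Prop) (A : RandAlg (List Bool) Bool) (X : ℕ) : ℝ :=
  classAverage Q (fun AB => if AB ∈ selmerLowSet then accept A AB else 0) X -
    classAverage Q (fun AB => if AB ∈ selmerLowSet then (1 : ℝ) else 0) X * classAverage Q (accept A) X

/-- `WithinParityCov_X(A)`: the parity-weighted mean of the two within-parity-class covariances of
acceptance with the Selmer bit (the "explained-away" part in the law of total covariance). [folklore] -/
def withinParityCov (A : RandAlg (List Bool) Bool) (X : ℕ) : ℝ :=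
  heightProportion (fun AB => AB ∈ selmerEvenSet) X * classCov (fun AB => AB ∈ selmerEvenSet) A X +
    heightProportion (fun AB => AB ∉ selmerEvenSet) X * classCov (fun AB => AB ∉ selmerEvenSet) A X

/-! ## The four registered stubs -/

/-- **STUB 1 (TRUE, M): predictor calibration.** For every randomized algorithm `A` (no complexity bound
needed) and every `X`, the average success is at most the constant rule plus twice the covariance of
acceptance with the Selmer bit; indeed `avgSuccess = 2·Cov + (1−π) + (2π−1)·t` with `t ∈ [0,1]`.
Leans on: `RandAlg.pr` = mass of the `PMF` `outputPMF` (`Pr[false] = 1 − Pr[true]`),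
`Computability.decode_encodeNat` + `Encodable.encode_injective` (membership `enc AB ∈ L ↔ AB ∈ selmerLowSet` on
the family, `mem_heightFamilyBelow_iff`), `Finset.sum_ite`, `heightProportion_le_one`.  Sources: Yao 1982
(predictor vs distinguisher), Goldreich FoC I §3.3.5; folklore. -/
theorem stub_successCalibration :
    ∀ (A : RandAlg (List Bool) Bool) (X : ℕ),
      avgSuccess A X ≤ max (prior X) (1 - prior X) + 2 * selmerCov A X := by
  sorry

/-- **STUB 2 (TRUE, M): law of total covariance along Selmer parity.**
`Cov = WithinParityCov + ParityCov·(E[b | even] − E[b | odd])` and `|E[b | even] − E[b | odd]| ≤ 1`, so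
`Cov ≤ WithinParityCov + |ParityCov|` (all junk cases `x/0 = 0` included).  Leans on: finite sums
(`Finset.sum_filter`, `Finset.filter_filter`, `Finset.card_filter`), `abs_le`.  Sources: folklore
(law of total covariance for a binary conditioning variable). -/
theorem stub_parityDecomposition :
    ∀ (A : RandAlg (List Bool) Bool) (X : ℕ),
      selmerCov A X ≤ withinParityCov A X + |parityCov A X| := by
  sorry

/-- **STUB 3 (HARDNESS — the parity channel; weakest, `∃ᶠ` form): Selmer parity is PPT-dark.**
For every probabilistic polynomial-time `A` there are infinitely many `X` at which the covariance of
acceptance with `[#Sel₂ is a square]` (= root number `+1` off `E(ℚ)[2] ≠ 0`) is at most `1/80` in absolute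
value.  Why plausibly true: `w(E_{A,B})` needs the sign `(−1)^{#(large multiplicative primes)}` of the
unfactored cofactor of `4A³+27B²` — Liouville-type parity, recoverable in polynomial time only on density
`≍ log log X / log X → 0` (refuter note on the item); why it might fail: a factoring-free route to the root
number (a `w`-oracle has `ParityCov = 1/4` under Poonen–Rains).  Leans on: nothing in the tree (conjecture-
grade).  Sources: arXiv:math/0610290 (Dokchitser parity), arXiv:math/0305435 (Helfgott), arXiv:1009.0287. -/
theorem stub_parityDark :
    ∀ A : RandAlg (List Bool) Bool, A.IsPolyTime id Computability.encodeBool →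
      ∃ᶠ X : ℕ in Filter.atTop, |parityCov A X| ≤ 1 / 80 := by
  sorry

/-- **STUB 4 (HARDNESS — the Poonen–Rains residue; `∀ᶠ` form): beyond parity the Selmer bit is PPT-dark.**
For every probabilistic polynomial-time `A`, eventually in `X`, the parity-weighted within-class covariance
of acceptance with `[#Sel₂ ≤ 2]` is at most `1/80`: conditioned on `dim Sel₂ mod 2`, no efficient statistic
of `(A, B)` correlates with `dim Sel₂ ≤ 1`.  Why plausibly true: the Poonen–Rains / BKLPR model makes
`Sel₂` random beyond parity, and Bhargava–Shankar's first moment is insensitive to every finite set of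
congruence conditions; why it might fail: a class-group-free 2-descent statistic, `a_p`-based Mestre–Nagao
sums with asymptotically non-vanishing conditional correlation, or local-condition biases in the conditional
law.  Leans on: nothing in the tree (conjecture-grade).  Sources: arXiv:1009.0287 (Conj. 1.1),
arXiv:1006.1002 (Thm 1.1), arXiv:2110.09063. -/
theorem stub_residueDark :
    ∀ A : RandAlg (List Bool) Bool, A.IsPolyTime id Computability.encodeBool →
      ∀ᶠ X : ℕ in Filter.atTop, withinParityCov A X ≤ 1 / 80 := by
  sorry

/-! ## Sorry-free composition -/

/-- **Composition of the line** (real glue; hypotheses = the four stub signatures, conclusion = the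
UNFOLDED crux so that `BeyondConstant_of` below is the only theorem whose head is the crux decl): at a
level `X` where the parity covariance is small (frequently, stub 3) and the residue covariance is small
(eventually, stub 4), stubs 2 and 1 give `avgSuccess ≤ max(π, 1−π) + 2(1/80 + 1/80)`. [folklore] -/
theorem beyondConstant_of_stubs
    (hcal : ∀ (A : RandAlg (List Bool) Bool) (X : ℕ),
      avgSuccess A X ≤ max (prior X) (1 - prior X) + 2 * selmerCov A X)
    (hdec : ∀ (A : RandAlg (List Bool) Bool) (X : ℕ),
      selmerCov A X ≤ withinParityCov A X + |parityCov A X|)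
    (hpar : ∀ A : RandAlg (List Bool) Bool, A.IsPolyTime id Computability.encodeBool →
      ∃ᶠ X : ℕ in Filter.atTop, |parityCov A X| ≤ 1 / 80)
    (hres : ∀ A : RandAlg (List Bool) Bool, A.IsPolyTime id Computability.encodeBool →
      ∀ᶠ X : ℕ in Filter.atTop, withinParityCov A X ≤ 1 / 80) :
    ∀ A : RandAlg (List Bool) Bool, A.IsPolyTime id Computability.encodeBool →
      ∃ᶠ X : ℕ in Filter.atTop, avgSuccess A X ≤ max (prior X) (1 - prior X) + 1 / 20 := by
  intro A hA
  refine ((hpar A hA).and_eventually (hres A hA)).mono fun X hX => ?_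
  obtain ⟨hparX, hresX⟩ := hX
  have h₁ := hcal A X
  have h₂ := hdec A X
  linarith

/-- The crux, restated over the named objects: `BeyondConstant` is by `Iff.rfl` (ζ-reduction of its three
`let`s and δ-unfolding of `avgSuccess`, `prior`, `selmerLang`, `enc`, `selmerLowSet`) the statement that every
PPT has, infinitely often, average success at most `max(π_X, 1 − π_X) + 1/20`. [folklore] -/
theorem beyondConstant_iff :
    BeyondConstant ↔
      ∀ A : RandAlg (List Bool) Bool, A.IsPolyTime id Computability.encodeBool →
        ∃ᶠ X : ℕ in Filter.atTop, avgSuccess A X ≤ max (prior X) (1 - prior X) + 1 / 20 :=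
  Iff.rfl

/-- **THE skeleton theorem** — the crux `BeyondConstant` BY NAME from the four declared stubs via the
sorry-free composition `beyondConstant_of_stubs` (`sorry` enters only through `stub_successCalibration`,
`stub_parityDecomposition`, `stub_parityDark`, `stub_residueDark`). [folklore] -/
theorem BeyondConstant_of : BeyondConstant :=
  beyondConstant_iff.2
    (beyondConstant_of_stubs stub_successCalibration stub_parityDecomposition stub_parityDark
      stub_residueDark)

end Summit.QuantumAdvantage.QuantumAdvantage.Cruxes.BeyondConstant.Birth

end
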